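import Literature.MathematicalPhysics.QuantumFieldTheory.Balaban1983to89.B9Eq373V3Analytic

/-!
# `Balaban1983to89.B9Eq382V3Operator` — B9, p. 407, (3.82): `V₃(A)` AS AN OPERATOR.  «Δ(U′U) = D*_{U′U}D_{U′U} + Δ′(U′U)» (p. 404) and
# the `V₃`-part of «Δ_a(U′U) = … = Δ_a(U) − V₁(A) + (Δ′(U′U) − Δ′(U)) − V₂(A) − … = Δ_a(U) − V₃(A) − P₁(A) − P₂(A). (3.82)» as
# identities of CONTINUOUS LINEAR OPERATORS on the sup-normed field space of a finite lattice; «The operator V₃(A) is a local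
# differential operator of the first order satisfying the bound (3.73)» as an OPERATOR-NORM bound; «depend analytically on A» as
# STRONG analyticity of the operator family `A ↦ V₃(A)`; v1.1

CITATION HEADER (lean-in-tree rule).  Audit cell `pub-balaban`, surge node-prover lineage pv27 (B9 pp. 390–392, 395–397, 404–407),
unit `b2b-balaban-pv27-g20` (journal CLAIM l.917 of the post-rotation `CLAIMS.log`, node B9-EQ382-V3-OPERATOR; third node of the seat,
after `B9Eq373V3` (p193995) and `B9Eq373V3Analytic` (p194222), which is imported BY NAME and brings `B9Eq373V3`, `B9Eq372Operator`
(p192387); nothing of them is restated).  Source: T. Bałaban, *Propagators for lattice gauge theories in a background field*, Commun.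
Math. Phys. **99** (1985) 389–434 [Balaban1985BackgroundPropagators] (cell paper B9; journal page = PDF page + 388), p. 404 [PDF 16]
(the paragraph before (3.69)), p. 405 [PDF 17] ((3.73)), p. 407 [PDF 19] ((3.82) and the paragraph after it), quoted from the page
renders `b2b-balaban-ref1/pages/1985-cmp99-background-propagators/…-p016-x4.png`, `…-p017-x4.png`, `…-p019-x4.png` READ AS IMAGES by
this seat (2026-08-19); (3.26) p. 395 and (3.39) p. 397 as quoted in the lineage (`B9Eq386Neumann`, `B9Eq372Operator`).
REVISION v1.1 (docstring only; every declaration byte-identical to v1 p194384): the p. 405 quotation of (3.73) restored VERBATIM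
(«V₁», the first member and the comma before «(3.73)») — DOCFIX-1 LOW of the cross-read `b2b-balaban-pv22-g22` (journal l.1210), confirmed on
the render `…-p017-x4.png` by this seat.

HONEST FRAMING (cell charter, verbatim in substance).  The cell audits Bałaban's papers; discharging its end statements would make
Bałaban's ultraviolet stability theorem unconditional inside this package — a constructive-QFT statement; it is NOT the continuum
limit and NOT the Clay problem.  THIS FILE DISCHARGES NOTHING of the series: it PACKAGES.  The lineage had `V₁(A)`, `V₂(A)` as
continuous linear operators with (3.71)/(3.75) as operator identities and (3.73) as operator-norm bounds (`B9Eq372Operator`), but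
`V₃(A)` only as the scalar `(V₃(A)A′)(b)` (`B9Eq373V3.V₃val`, with (3.73) pointwise: `eq373_V₃`) and `Δ′` only pointwise
(`B9Eq310Hermitian.deltaPrimeOp`, additive and homogeneous: `deltaPrimeOp_add/_smul`).  Here `Δ′(V)`, `Δ(V) = η⁻²D*_VD_V + Δ′(V)` and
`V₃(A)` become continuous linear operators, the `V₃`-regrouping of (3.82) becomes an operator identity, (3.73) for `V₃` an
operator-norm bound, and the analyticity sentence the strong analyticity of `A ↦ V₃(A)`.  Bookkeeping over the lineage's theorems;
the one analytic input not already in the tree — continuity of `A′ ↦ Δ′(V)A′` — is read off from this seat's `B9Eq373V3Analytic`.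

ABSOLUTE RULE honoured: no programme-internal statement is cited; Mathlib (`ContinuousLinearMap`, `opNorm_le_bound`, `AnalyticAt.pi`)
and the lineage's definitions and theorems are used BY NAME; every theorem below is kernel-checked.  `P(U)`, `P′(A)`, `P₁(A)` ((3.68),
(3.76), (3.77)) and `P₂(A)` ((3.83)) — lanes r1/b10 — are NOT touched: of `Δ_a(V) = Δ(V) + D_VR(V)D*_V + Q*(V)aQ(V)` ((3.26)) only the
DIFFERENTIAL terms `Δ(V) + η⁻²D_VD*_V` (i.e. `R ↦ I`, no averaging term) are formed, because these are exactly the terms the print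
regroups into `−V₃(A)`; the rest of (3.82) is `B9Eq386Neumann`'s abstract ring algebra with `P₁`, `P₂` as letters.

LETTERS AND NORMALISATION (as in the lineage).  `𝔸` a complete normed ℂ-algebra, sites `S` and directions `ι` FINITE (the print's
`T_η` is a finite torus), shifts `T`, background `U : ι → S → 𝔸ˣ` (arbitrary units; `‖U(b′)^{±1}‖ ≤ 1` where a bound needs it), exponent
field `A`, `U′U = prodCfg U η A`, test field `A′`, field space `ι → S → 𝔸` with the Pi sup norm `|A′| = max_κ sup_z ‖A′_κ(z)‖` ((3.39);
`B9Eq372Operator.norm_apply_le_pi`).  SCALES: the lineage's `lapDDL`/`gradDivL`/`V₁L`/`V₂L` are `η²` × the print's `D*D`, `DD*`, `V₁(A)`,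
`V₂(A)` (`D¹ = ηD^η`), while `deltaPrimeOp` and `V₃val` are at the printed scale; hence the factors `η⁻²` (as `((η : ℂ)⁻¹)²`, exactly as
in `B9Eq373V3.V₃val`) in `deltaL`, `dSumL`, `V₃L` below.

WHAT IS IN PRINT (verbatim).  p. 404 [PDF 16]: «Let us consider at first the operator Δ(U′U). It is a sum of two operators,
Δ(U′U) = D*_{U′U}D_{U′U} + Δ′(U′U). From the formula (3.10) it follows that Δ′(U′U) is a small perturbation itself […] It is easy to see
that for the difference Δ′(U′U) − Δ′(U) we have a bound similar to (3.69), but with additional factor α₁.»  p. 405 [PDF 17]: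
«|(V₁(A)A′)(b)| ≤ O(1)(|A||∇A′| + |∇A||A′| + |A|²|A′|) ≤ O(1)α₁((L^jη)⁻¹|∇A′| + (L^jη)⁻²|A′|), b ∈ Ω_j, (3.73)» (stated for `V₁`; the
print applies (3.73) to `V₃` on p. 407).  p. 407 [PDF 19]: «Combining the expansions (3.71), (3.76) and
(3.80) we get Δ_a(U′U) = D*_{U′U}D_{U′U} + Δ′(U′U) + D_{U′U}R(U′U)D*_{U′U} + Q*(U′U)aQ(U′U) = Δ_a(U) − V₁(A) + (Δ′(U′U) − Δ′(U)) − V₂(A) −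
P₁(A) + F₂*(A)aQ(U) + Q*(U)aF₂(A) + F₂*(A)aF₂(A) = Δ_a(U) − V₃(A) − P₁(A) − P₂(A). (3.82) The operator V₃(A) is a local differential
operator of the first order satisfying the bound (3.73). […] The operators V₃(A), P₁(A), P₂(A) depend analytically on A in the domain
(3.37).»

WHAT THIS FILE PROVES (all [folklore]; finite lattice `[Fintype ι] [Fintype S]`):
* §1 `Δ′` AND `Δ` AS OPERATORS: `continuous_deltaPrimeOp_apply`, `continuous_deltaPrimeOp` (from `B9Eq373V3Analytic.analyticAt_deltaPrimeOp`),
  **`deltaPrimeLin`**, **`deltaPrimeL T V η`** (`Δ′(V)` as a continuous linear operator; `deltaPrimeL_apply`), **`deltaL T V η`**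
  `:= η⁻²·lapDDL + deltaPrimeL` («Δ(U′U) = D*_{U′U}D_{U′U} + Δ′(U′U)»; `deltaL_apply`), **`dSumL T V η`** `:= deltaL + η⁻²·gradDivL` (the
  differential terms of `Δ_a`).
* §2 `V₃` AS AN OPERATOR: **`V₃L T U η A`** `:= η⁻²·V₁L − (deltaPrimeL(U′U) − deltaPrimeL(U)) + η⁻²·V₂L`, **`V₃L_apply`** (`= B9Eq373V3.V₃val`,
  bond by bond), `V₃L_apply_fun`, **`V₃L_zero`** (`V₃(0) = 0`).
* §3 (3.82) AS OPERATOR IDENTITIES: **`deltaL_prodCfg`** (`Δ(U′U) = Δ(U) − η⁻²V₁(A) + (Δ′(U′U) − Δ′(U))`), **`dSumL_prodCfg_expand`** (the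
  second member: `… − η⁻²V₂(A)`), **`eq382_V₃`** (the third member, `V₃`-part: `(Δ + η⁻²DD*)(U′U) = (Δ + η⁻²DD*)(U) − V₃(A)`), `V₃L_eq_sub`.
* §4 OPERATOR-NORM BOUNDS (sup norm (3.39); group-valued background, (3.37)-type bounds on `A`, (3.35)-output on the plaquettes):
  `kΔ_nonneg`, **`norm_deltaPrimeL_sub_apply_le`** / **`opNorm_deltaPrimeL_sub_le`** (p. 404: `‖Δ′(U′U) − Δ′(U)‖_{op} ≤ (d − 1)α₁k_Δ(L^jη)⁻²`,
  from `B9Eq373V3.eq369_diff`), **`CV₃`**, `CV₃_nonneg`, **`norm_V₃L_apply_le`** / **`opNorm_V₃L_le`** ((3.73) for `V₃`: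
  `‖V₃(A)‖_{op} ≤ CV₃ = α₁[40d(L^jη)⁻¹η⁻¹ + (d(10 + 12α₁e^{2α₁}(…)) + (d − 1)k_Δ)(L^jη)⁻²]`, from `B9Eq373V3.eq373_V₃` with `|∇A′| ≤ 2η⁻¹|A′|`).
* §5 STRONG ANALYTICITY: **`analyticOnNhd_deltaPrimeL_prodCfg_apply`** (`A ↦ Δ′(U′U)A′` entire, field-valued), **`analyticOnNhd_V₃L_apply`**
  (`A ↦ V₃(A)A′` entire for every `A′`), **`analyticOnNhd_V₃L_apply_joint`** (`(A, A′) ↦ V₃(A)A′`), `differentiable_V₃L_apply`,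
  `continuous_V₃L_apply` (strong continuity) — from `B9Eq373V3Analytic` and Mathlib's `AnalyticAt.pi`.
* §6 SANITY (`example`s): (3.82) at `A = 0`; `Δ′(U′U) = Δ′(U)` at `A = 0`; `V₃L` vs `V₃val`; `CV₃ = 0` at `α₁ = 0`; analyticity at `0`.

RELATED IN THE TREE, NOT DUPLICATED (searched 2026-08-19: MODULE-MAP rows B9; `grep -rn "deltaPrimeOp\|V₃" Balaban1983to89/`):
`B9Eq372Operator` (operators `lapDDL`, `gradDivL`, `F₁L`, `V₁L`, `F₂L`, `V₂L`, identities `lapDDL_prodCfg`/`gradDivL_prodCfg`, op-norm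
bounds — imported and USED); `B9Eq373V3` (scalar `V₃val`, `eq369_diff`, `eq373_V₃` — USED); `B9Eq386Neumann` (the abstract ring algebra
of (3.76)/(3.82)/(3.84)/(3.86) with `V₃`, `P₁`, `P₂` as letters — no concrete operators); `B9Eq310Hermitian` (`Δ′` pointwise, additive,
homogeneous, Hermitian — no packaging); no leaf packages `Δ′(V)` or `V₃(A)` as operators or states (3.82)'s `V₃`-part concretely.

NOT PROVED HERE, NOT CLAIMED: the full (3.82) with `D_VR(V)D*_V` and `Q*(V)aQ(V)` (needs `P`, `P′`, `P₁`, `F₂`, `Q` — other lanes;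
abstractly `B9Eq386Neumann`); (3.84)–(3.86) for the concrete operators (they need `G(U)` and Theorem 3.3); analyticity of `A ↦ V₃(A)` in
OPERATOR NORM (only strong analyticity is proved; on a finite lattice over an infinite-dimensional `𝔸` the two are not formally
identified here); the gradient-seminorm form of (3.73) at operator level (the sup-norm space carries `|A′|` only, so `|∇A′|` is
dominated by `2η⁻¹|A′|` — a weaker but honest reading; the sharp pointwise form is `B9Eq373V3.eq373_V₃`); Hermitian symmetry of `V₃(A)`;
`Ω_j`-localisation.  The positivity binders `0 ≤ α₁`, `0 ≤ C₀` of §4 are explicit because an empty lattice does not force them.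
Records: GAPS C-pv27-82 (no divergence).  NOT summit progress.
-/

noncomputable section

namespace Literature.MathematicalPhysics.QuantumFieldTheory.Balaban1983to89.B9Eq382V3Operator

open Complex
open Literature.MathematicalPhysics.QuantumFieldTheory.Balaban1983to89
open Literature.MathematicalPhysics.QuantumFieldTheory.Balaban1983to89.B9Eq39Adjoint
open Literature.MathematicalPhysics.QuantumFieldTheory.Balaban1983to89.B9Eq310Hermitian
open Literature.MathematicalPhysics.QuantumFieldTheory.Balaban1983to89.B9Eq369Product
open Literature.MathematicalPhysics.QuantumFieldTheory.Balaban1983to89.B9Eq369Small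
open Literature.MathematicalPhysics.QuantumFieldTheory.Balaban1983to89.B9Eq371Composition
open Literature.MathematicalPhysics.QuantumFieldTheory.Balaban1983to89.B9Eq375Composition
open Literature.MathematicalPhysics.QuantumFieldTheory.Balaban1983to89.B9Eq372Operator
open Literature.MathematicalPhysics.QuantumFieldTheory.Balaban1983to89.B9Eq386Neumann
open Literature.MathematicalPhysics.QuantumFieldTheory.Balaban1983to89.B9Eq373V3
open Literature.MathematicalPhysics.QuantumFieldTheory.Balaban1983to89.B9Eq373V3Analytic

section Ops

variable {𝔸 : Type*} [NormedRing 𝔸] [NormedAlgebra ℂ 𝔸] [CompleteSpace 𝔸] {S : Type*} {ι : Type*}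
variable [Fintype ι] [Fintype S] [LinearOrder ι]
variable (T : ι → Equiv.Perm S)

/-! ## §1 `Δ′(V)` and `Δ(V) = η⁻²D*_VD_V + Δ′(V)` as continuous linear operators -/

/-- `A′ ↦ (Δ′(V)A′)(b)` is continuous on the field space of a finite lattice (product = sup-norm topology) — read off from the
analyticity of this seat's `B9Eq373V3Analytic.analyticAt_deltaPrimeOp` along the identity parametrisation. [folklore]
[cite: Balaban1985BackgroundPropagators, (3.10) p.392, (3.39) p.397] -/
theorem continuous_deltaPrimeOp_apply (V : ι → S → 𝔸ˣ) (η : ℝ) (μ : ι) (x : S) :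
    Continuous fun A' : ι → S → 𝔸 => deltaPrimeOp T V η A' μ x :=
  continuous_iff_continuousAt.2 fun A₀ =>
    (analyticAt_deltaPrimeOp (cfgAnalyticAt_const V A₀) η (𝒜 := fun A' => A')
      (fun κ z => analyticAt_apply₂ κ z A₀) μ x).continuousAt

/-- `A′ ↦ Δ′(V)A′` is continuous (field-valued). [folklore] [cite: Balaban1985BackgroundPropagators, (3.10) p.392] -/
theorem continuous_deltaPrimeOp (V : ι → S → 𝔸ˣ) (η : ℝ) :
    Continuous fun A' : ι → S → 𝔸 => deltaPrimeOp T V η A' :=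
  continuous_pi fun μ => continuous_pi fun x => continuous_deltaPrimeOp_apply T V η μ x

/-- **`Δ′(V)` AS A ℂ-LINEAR OPERATOR** on vector fields `ι → S → 𝔸` (the lineage's `deltaPrimeOp_add` / `deltaPrimeOp_smul`,
`B9Eq310Hermitian`). [folklore] [cite: Balaban1985BackgroundPropagators, (3.10) p.392] -/
def deltaPrimeLin (V : ι → S → 𝔸ˣ) (η : ℝ) : (ι → S → 𝔸) →ₗ[ℂ] (ι → S → 𝔸) where
  toFun A' := deltaPrimeOp T V η A'
  map_add' A' B' := by funext μ x; exact deltaPrimeOp_add T V η A' B' μ x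
  map_smul' c A' := by funext μ x; exact deltaPrimeOp_smul T V η c A' μ x

/-- **`Δ′(V)` AS A CONTINUOUS LINEAR OPERATOR** on the sup-normed field space (3.39) of a finite lattice. [folklore]
[cite: Balaban1985BackgroundPropagators, (3.10) p.392, (3.39) p.397] -/
def deltaPrimeL (V : ι → S → 𝔸ˣ) (η : ℝ) : (ι → S → 𝔸) →L[ℂ] (ι → S → 𝔸) :=
  ⟨deltaPrimeLin T V η, continuous_deltaPrimeOp T V η⟩

/-- [folklore] -/
@[simp] theorem deltaPrimeL_apply (V : ι → S → 𝔸ˣ) (η : ℝ) (A' : ι → S → 𝔸) :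
    deltaPrimeL T V η A' = deltaPrimeOp T V η A' := rfl

/-- **`Δ(V) = η⁻²·D*_VD_V + Δ′(V)`** as a continuous linear operator: «It is a sum of two operators, Δ(U′U) = D*_{U′U}D_{U′U} +
Δ′(U′U)» (p. 404; the lineage's `lapDDL` is `η²` × the print's `D*D`, `D¹ = ηD^η`, whence the factor `η⁻²`; `deltaPrimeL` is at the
printed scale). [folklore] [cite: Balaban1985BackgroundPropagators, p.404 before (3.69); (3.71) p.405] -/
def deltaL (V : ι → S → 𝔸ˣ) (η : ℝ) : (ι → S → 𝔸) →L[ℂ] (ι → S → 𝔸) :=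
  (((η : ℂ)⁻¹) ^ 2) • lapDDL T V + deltaPrimeL T V η

/-- `(Δ(V)A′)(b) = η⁻²(D*_VD_VA′)(b) + (Δ′(V)A′)(b)`. [folklore] [cite: Balaban1985BackgroundPropagators, p.404 before (3.69)] -/
theorem deltaL_apply (V : ι → S → 𝔸ˣ) (η : ℝ) (A' : ι → S → 𝔸) (μ : ι) (x : S) :
    deltaL T V η A' μ x = (((η : ℂ)⁻¹) ^ 2) • lapDD T V A' μ x + deltaPrimeOp T V η A' μ x := by
  simp only [deltaL, FunLike.coe_add, FunLike.coe_smul, Pi.smul_apply, Pi.add_apply, lapDDL_apply, deltaPrimeL_apply]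

/-- **`Δ(V) + η⁻²·D_VD*_V`** — the three configuration-dependent DIFFERENTIAL terms of `Δ_a(V) = Δ(V) + D_VR(V)D*_V + Q*(V)aQ(V)`
((3.26)) with `R ↦ I` and the averaging term dropped: exactly the terms whose expansions (3.71), p. 404 and (3.75) the print regroups
into `−V₃(A)` in (3.82) (the `−D_VP(V)D*_V` and `Q*aQ` terms produce `P₁(A)`, `P₂(A)` — other lanes). [folklore]
[cite: Balaban1985BackgroundPropagators, (3.82) p.407; (3.26) p.395] -/
def dSumL (V : ι → S → 𝔸ˣ) (η : ℝ) : (ι → S → 𝔸) →L[ℂ] (ι → S → 𝔸) :=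
  deltaL T V η + (((η : ℂ)⁻¹) ^ 2) • gradDivL T V

variable (U : ι → S → 𝔸ˣ)

/-! ## §2 `V₃(A)` as a continuous linear operator -/

/-- **`V₃(A)` AS A CONTINUOUS LINEAR OPERATOR**: `V₃(A) = η⁻²V₁(A) − (Δ′(U′U) − Δ′(U)) + η⁻²V₂(A)` (the second and third members of
(3.82); `V₁L`, `V₂L` of `B9Eq372Operator` are `η²` × the print's `V₁(A)`, `V₂(A)`).  Its values are the lineage's `B9Eq373V3.V₃val`
(`V₃L_apply`). [folklore] [cite: Balaban1985BackgroundPropagators, (3.82) p.407] -/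
def V₃L (η : ℝ) (A : ι → S → 𝔸) : (ι → S → 𝔸) →L[ℂ] (ι → S → 𝔸) :=
  (((η : ℂ)⁻¹) ^ 2) • V₁L T U η A - (deltaPrimeL T (prodCfg U η A) η - deltaPrimeL T U η)
    + (((η : ℂ)⁻¹) ^ 2) • V₂L T U η A

/-- `(V₃L A A′)(b) = (V₃(A)A′)(b)` — the operator packages exactly `B9Eq373V3.V₃val`. [folklore] [cite: Balaban1985BackgroundPropagators, (3.82) p.407] -/
theorem V₃L_apply (η : ℝ) (A A' : ι → S → 𝔸) (μ : ι) (x : S) :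
    V₃L T U η A A' μ x = V₃val T U η A A' μ x := by
  simp only [V₃L, FunLike.coe_add, FunLike.coe_sub, FunLike.coe_smul, Pi.smul_apply, Pi.add_apply, Pi.sub_apply,
    V₁L_apply, V₂L_apply, deltaPrimeL_apply, V₃val_eq]

/-- `V₃L A A′ = V₃(A)A′` as fields. [folklore] -/
theorem V₃L_apply_fun (η : ℝ) (A A' : ι → S → 𝔸) : V₃L T U η A A' = V₃val T U η A A' := by
  funext μ x; exact V₃L_apply T U η A A' μ x

/-- **`V₃(0) = 0`**: no fluctuation field, no perturbation (`U′U = U` at `A = 0`, `B9Eq369Product.prodCfg_zero`; `V₁L_zero`, `V₂L_zero`).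
[folklore] [cite: Balaban1985BackgroundPropagators, (3.82) p.407] -/
theorem V₃L_zero (η : ℝ) : V₃L T U η (0 : ι → S → 𝔸) = 0 := by
  ext A' μ x
  rw [V₃L, V₁L_zero, V₂L_zero, prodCfg_zero, sub_self, sub_zero]
  simp only [FunLike.coe_add, FunLike.coe_smul, Pi.add_apply, Pi.smul_apply, zero_apply, Pi.zero_apply,
    smul_zero, add_zero]

/-! ## §3 (3.82), the V₃-part, as operator identities -/

/-- **p. 404 + (3.71) AT OPERATOR LEVEL**: `Δ(U′U) = Δ(U) − η⁻²V₁(A) + (Δ′(U′U) − Δ′(U))` — the `Δ`-part of the second member of (3.82)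
(`B9Eq372Operator.lapDDL_prodCfg` for the `D*D` term; the `Δ′` term is regrouped verbatim). [folklore]
[cite: Balaban1985BackgroundPropagators, (3.82) p.407; p.404 before (3.69); (3.71) p.405] -/
theorem deltaL_prodCfg (η : ℝ) (A : ι → S → 𝔸) :
    deltaL T (prodCfg U η A) η
      = deltaL T U η - (((η : ℂ)⁻¹) ^ 2) • V₁L T U η A + (deltaPrimeL T (prodCfg U η A) η - deltaPrimeL T U η) := by
  simp only [deltaL, lapDDL_prodCfg, smul_sub]
  abel

/-- **THE SECOND MEMBER OF (3.82), DIFFERENTIAL PART**: `(Δ + η⁻²DD*)(U′U) = (Δ + η⁻²DD*)(U) − η⁻²V₁(A) + (Δ′(U′U) − Δ′(U)) − η⁻²V₂(A)`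
(«= Δ_a(U) − V₁(A) + (Δ′(U′U) − Δ′(U)) − V₂(A) − …», the omitted terms being the `P₁`, `P₂` groups). [folklore]
[cite: Balaban1985BackgroundPropagators, (3.82) p.407; (3.71), (3.75) p.405] -/
theorem dSumL_prodCfg_expand (η : ℝ) (A : ι → S → 𝔸) :
    dSumL T (prodCfg U η A) η
      = dSumL T U η - (((η : ℂ)⁻¹) ^ 2) • V₁L T U η A + (deltaPrimeL T (prodCfg U η A) η - deltaPrimeL T U η)
          - (((η : ℂ)⁻¹) ^ 2) • V₂L T U η A := by
  simp only [dSumL, deltaL, lapDDL_prodCfg, gradDivL_prodCfg, smul_sub]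
  abel

/-- **THE THIRD MEMBER OF (3.82), `V₃`-PART — `(Δ + η⁻²DD*)(U′U) = (Δ + η⁻²DD*)(U) − V₃(A)`** as an identity of continuous linear
operators («= Δ_a(U) − V₃(A) − P₁(A) − P₂(A)» restricted to the terms that make up `V₃`). [folklore]
[cite: Balaban1985BackgroundPropagators, (3.82) p.407] -/
theorem eq382_V₃ (η : ℝ) (A : ι → S → 𝔸) : dSumL T (prodCfg U η A) η = dSumL T U η - V₃L T U η A := by
  simp only [dSumL, deltaL, V₃L, lapDDL_prodCfg, gradDivL_prodCfg, smul_sub]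
  abel

/-- Equivalently `V₃(A) = (Δ + η⁻²DD*)(U) − (Δ + η⁻²DD*)(U′U)`: the perturbation IS the difference of the operators. [folklore]
[cite: Balaban1985BackgroundPropagators, (3.82) p.407] -/
theorem V₃L_eq_sub (η : ℝ) (A : ι → S → 𝔸) : V₃L T U η A = dSumL T U η - dSumL T (prodCfg U η A) η := by
  rw [eq382_V₃, sub_sub_cancel]

/-! ## §4 Operator-norm bounds on the sup-normed field space -/

omit [NormedAlgebra ℂ 𝔸] [CompleteSpace 𝔸] [Fintype ι] [Fintype S] [LinearOrder ι] in
/-- `0 ≤ k_Δ(α₁, C₀)` for `α₁, C₀ ≥ 0` (`B9Eq373V3.kΔ`). [folklore] -/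
theorem kΔ_nonneg {α₁ C₀ : ℝ} (hα : 0 ≤ α₁) (hC : 0 ≤ C₀) : 0 ≤ kΔ α₁ C₀ := by
  have := kP_nonneg hα hC
  unfold kΔ
  positivity

/-- **p. 404 IN SUP NORM**: «for the difference Δ′(U′U) − Δ′(U) we have a bound similar to (3.69), but with additional factor α₁» —
`‖(Δ′(U′U) − Δ′(U))A′‖ ≤ (d − 1)·α₁·k_Δ(α₁, C₀)·(L^jη)⁻²·‖A′‖` on the sup-normed field space, from the lineage's pointwise
`B9Eq373V3.eq369_diff` (group-valued background `‖U(b′)^{±1}‖ ≤ 1`, (3.37)-type bounds on `A` at scale `L^jη`, the (3.35)-output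
`‖U(∂p) − 1‖ ≤ C₀L^{−2j}` on every plaquette; `α₁, C₀ ≥ 0` explicitly, as the lattice may be empty). [folklore]
[cite: Balaban1985BackgroundPropagators, p.404 after (3.69); (3.39) p.397] -/
theorem norm_deltaPrimeL_sub_apply_le {η L α₁ C₀ a g : ℝ} {j : ℕ} (hη : 0 < η) (hL : 1 ≤ L) (hα : 0 ≤ α₁) (hC : 0 ≤ C₀)
    (hU : ∀ κ z, ‖(U κ z : 𝔸)‖ ≤ 1) (hU' : ∀ κ z, ‖(((U κ z)⁻¹ : 𝔸ˣ) : 𝔸)‖ ≤ 1)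
    (A : ι → S → 𝔸) (hA : ∀ κ z, ‖A κ z‖ ≤ a) (ha : a ≤ α₁ * (L ^ j * η)⁻¹)
    (hdA : ∀ κ τ z, ‖covD T U κ (A τ) z‖ ≤ g) (hg : g ≤ η * (α₁ * ((L ^ j * η)⁻¹) ^ 2))
    (h35 : ∀ κ ν y, ‖(plaqU T U κ ν y : 𝔸) - 1‖ ≤ C₀ * ((L ^ j)⁻¹) ^ 2) (A' : ι → S → 𝔸) :
    ‖(deltaPrimeL T (prodCfg U η A) η - deltaPrimeL T U η) A'‖
      ≤ ((Fintype.card ι - 1 : ℕ) : ℝ) * (α₁ * kΔ α₁ C₀ * ((L ^ j * η) ^ 2)⁻¹) * ‖A'‖ := by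
  have hk := kΔ_nonneg hα hC
  refine pi_norm_le_of_forall₂ (by positivity) _ fun μ x => ?_
  rw [FunLike.coe_sub, Pi.sub_apply, Pi.sub_apply, Pi.sub_apply, deltaPrimeL_apply, deltaPrimeL_apply]
  have h := eq369_diff T U hη hL hU hU' A A' hA ha hdA hg μ x
    (fun κ ν y _ => ⟨norm_apply_le_pi A' κ y, norm_apply_le_pi A' ν _, norm_apply_le_pi A' κ _, norm_apply_le_pi A' ν y⟩)
    (fun κ ν y _ => h35 κ ν y)
  refine h.trans (le_of_eq ?_)
  ring

/-- **… AS AN OPERATOR-NORM BOUND**: `‖Δ′(U′U) − Δ′(U)‖_{op} ≤ (d − 1)·α₁·k_Δ(α₁, C₀)·(L^jη)⁻²`. [folklore]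
[cite: Balaban1985BackgroundPropagators, p.404 after (3.69)] -/
theorem opNorm_deltaPrimeL_sub_le {η L α₁ C₀ a g : ℝ} {j : ℕ} (hη : 0 < η) (hL : 1 ≤ L) (hα : 0 ≤ α₁) (hC : 0 ≤ C₀)
    (hU : ∀ κ z, ‖(U κ z : 𝔸)‖ ≤ 1) (hU' : ∀ κ z, ‖(((U κ z)⁻¹ : 𝔸ˣ) : 𝔸)‖ ≤ 1)
    (A : ι → S → 𝔸) (hA : ∀ κ z, ‖A κ z‖ ≤ a) (ha : a ≤ α₁ * (L ^ j * η)⁻¹)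
    (hdA : ∀ κ τ z, ‖covD T U κ (A τ) z‖ ≤ g) (hg : g ≤ η * (α₁ * ((L ^ j * η)⁻¹) ^ 2))
    (h35 : ∀ κ ν y, ‖(plaqU T U κ ν y : 𝔸) - 1‖ ≤ C₀ * ((L ^ j)⁻¹) ^ 2) :
    ‖deltaPrimeL T (prodCfg U η A) η - deltaPrimeL T U η‖
      ≤ ((Fintype.card ι - 1 : ℕ) : ℝ) * (α₁ * kΔ α₁ C₀ * ((L ^ j * η) ^ 2)⁻¹) := by
  have hk := kΔ_nonneg hα hC
  exact ContinuousLinearMap.opNorm_le_bound _ (by positivity)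
    (norm_deltaPrimeL_sub_apply_le T U hη hL hα hC hU hU' A hA ha hdA hg h35)

omit [NormedAlgebra ℂ 𝔸] [CompleteSpace 𝔸] [Fintype ι] [Fintype S] [LinearOrder ι] in
/-- The constant of (3.73) for `V₃` in operator norm on the sup-normed space: `CV₃ = α₁·[40d·(L^jη)⁻¹η⁻¹ + (d(10 + 12α₁e^{2α₁}(3 + 2α₁ +
α₁²e^{2α₁})) + (d − 1)k_Δ(α₁, C₀))·(L^jη)⁻²]` — `B9Eq373V3.eq373_V₃`'s constant with `|∇^η_UA′| ≤ 2η⁻¹|A′|`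
(`B9Eq372Operator.norm_covD_le_pi` at `ρ = 1`). [folklore] [cite: Balaban1985BackgroundPropagators, (3.73) p.405] -/
def CV₃ (d : ℕ) (η L : ℝ) (j : ℕ) (α₁ C₀ : ℝ) : ℝ :=
  α₁ * (d * (40 * (L ^ j * η)⁻¹ * η⁻¹)
    + (d * (10 + 12 * α₁ * Real.exp (2 * α₁) * (3 + 2 * α₁ + α₁ ^ 2 * Real.exp (2 * α₁)))
        + ((d - 1 : ℕ) : ℝ) * kΔ α₁ C₀) * ((L ^ j * η) ^ 2)⁻¹)

omit [NormedAlgebra ℂ 𝔸] [CompleteSpace 𝔸] [Fintype ι] [Fintype S] [LinearOrder ι] in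
/-- `0 ≤ CV₃`. [folklore] -/
theorem CV₃_nonneg (d : ℕ) {η L : ℝ} (j : ℕ) {α₁ C₀ : ℝ} (hη : 0 ≤ η) (hL : 0 ≤ L) (hα : 0 ≤ α₁) (hC : 0 ≤ C₀) :
    0 ≤ CV₃ d η L j α₁ C₀ := by
  have hk := kΔ_nonneg hα hC
  unfold CV₃
  positivity

/-- **(3.73) FOR `V₃` IN SUP NORM**: `‖V₃(A)A′‖ ≤ CV₃·‖A′‖` — «The operator V₃(A) is a local differential operator of the first order
satisfying the bound (3.73)» read on the sup-normed field space (3.39) (the gradient seminorm `|∇A′|` of (3.73) dominated by `2η⁻¹|A′|`),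
from the lineage's pointwise `B9Eq373V3.eq373_V₃`; hypotheses as in `norm_deltaPrimeL_sub_apply_le`. [folklore]
[cite: Balaban1985BackgroundPropagators, p.407 after (3.82); (3.73) p.405; (3.39) p.397] -/
theorem norm_V₃L_apply_le {η L α₁ C₀ a g : ℝ} {j : ℕ} (hη : 0 < η) (hL : 1 ≤ L) (hα : 0 ≤ α₁) (hC : 0 ≤ C₀)
    (hU : ∀ κ z, ‖(U κ z : 𝔸)‖ ≤ 1) (hU' : ∀ κ z, ‖(((U κ z)⁻¹ : 𝔸ˣ) : 𝔸)‖ ≤ 1)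
    (A : ι → S → 𝔸) (hA : ∀ κ z, ‖A κ z‖ ≤ a) (ha : a ≤ α₁ * (L ^ j * η)⁻¹)
    (hdA : ∀ κ τ z, ‖covD T U κ (A τ) z‖ ≤ g) (hg : g ≤ η * (α₁ * ((L ^ j * η)⁻¹) ^ 2))
    (h35 : ∀ κ ν y, ‖(plaqU T U κ ν y : 𝔸) - 1‖ ≤ C₀ * ((L ^ j)⁻¹) ^ 2) (A' : ι → S → 𝔸) :
    ‖V₃L T U η A A'‖ ≤ CV₃ (Fintype.card ι) η L j α₁ C₀ * ‖A'‖ := by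
  have hCV := CV₃_nonneg (Fintype.card ι) j hη.le (zero_le_one.trans hL) hα hC
  refine pi_norm_le_of_forall₂ (by positivity) _ fun μ x => ?_
  rw [V₃L_apply]
  have hone : ∀ κ τ z, ‖covD T U κ (A' τ) z‖ ≤ 2 * ‖A'‖ := fun κ τ z => by
    have h := norm_covD_le_pi T U hU hU' A' κ τ z
    norm_num at h
    linarith
  have h := eq373_V₃ T U hη hL hU hU' A A' hA ha (fun κ z => norm_apply_le_pi A' κ z) hdA hg hone μ x
    (fun κ ν y _ => h35 κ ν y)
  refine h.trans (le_of_eq ?_)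
  unfold CV₃
  ring

/-- **(3.73) FOR `V₃` AS AN OPERATOR-NORM BOUND**: `‖V₃(A)‖_{op} ≤ CV₃ = O(1)·α₁·((L^jη)⁻¹η⁻¹ + (L^jη)⁻²)`. [folklore]
[cite: Balaban1985BackgroundPropagators, p.407 after (3.82); (3.73) p.405] -/
theorem opNorm_V₃L_le {η L α₁ C₀ a g : ℝ} {j : ℕ} (hη : 0 < η) (hL : 1 ≤ L) (hα : 0 ≤ α₁) (hC : 0 ≤ C₀)
    (hU : ∀ κ z, ‖(U κ z : 𝔸)‖ ≤ 1) (hU' : ∀ κ z, ‖(((U κ z)⁻¹ : 𝔸ˣ) : 𝔸)‖ ≤ 1)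
    (A : ι → S → 𝔸) (hA : ∀ κ z, ‖A κ z‖ ≤ a) (ha : a ≤ α₁ * (L ^ j * η)⁻¹)
    (hdA : ∀ κ τ z, ‖covD T U κ (A τ) z‖ ≤ g) (hg : g ≤ η * (α₁ * ((L ^ j * η)⁻¹) ^ 2))
    (h35 : ∀ κ ν y, ‖(plaqU T U κ ν y : 𝔸) - 1‖ ≤ C₀ * ((L ^ j)⁻¹) ^ 2) :
    ‖V₃L T U η A‖ ≤ CV₃ (Fintype.card ι) η L j α₁ C₀ :=
  ContinuousLinearMap.opNorm_le_bound _ (CV₃_nonneg (Fintype.card ι) j hη.le (zero_le_one.trans hL) hα hC)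
    (norm_V₃L_apply_le T U hη hL hα hC hU hU' A hA ha hdA hg h35)

/-! ## §5 Strong analyticity of the operator families `A ↦ Δ′(U′U)`, `A ↦ V₃(A)` -/

/-- **STRONG ANALYTICITY OF `A ↦ Δ′(U′U)`**: for every `A′` the field-valued map `A ↦ Δ′(U′U)A′` is entire on the field space
(`B9Eq373V3Analytic.analyticOnNhd_deltaPrimeOp_prodCfg` + `AnalyticAt.pi`). [folklore]
[cite: Balaban1985BackgroundPropagators, p.407 after (3.83); (3.10) p.392] -/
theorem analyticOnNhd_deltaPrimeL_prodCfg_apply (η : ℝ) (A' : ι → S → 𝔸) :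
    AnalyticOnNhd ℂ (fun A : ι → S → 𝔸 => deltaPrimeL T (prodCfg U η A) η A') Set.univ := fun A₀ _ => by
  simp only [deltaPrimeL_apply]
  exact AnalyticAt.pi fun μ => AnalyticAt.pi fun x => analyticOnNhd_deltaPrimeOp_prodCfg T U η A' μ x A₀ trivial

/-- **STRONG ANALYTICITY OF THE OPERATOR FAMILY `A ↦ V₃(A)`**: for every `A′` the field-valued map `A ↦ V₃(A)A′` is entire
(«The operators V₃(A), … depend analytically on A», in the strong = pointwise-in-`A′` sense; `B9Eq373V3Analytic.analyticOnNhd_V₃val`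
+ `AnalyticAt.pi`).  Analyticity of `A ↦ V₃(A)` in OPERATOR NORM is not asserted here. [folklore]
[cite: Balaban1985BackgroundPropagators, p.407 after (3.83)] -/
theorem analyticOnNhd_V₃L_apply (η : ℝ) (A' : ι → S → 𝔸) :
    AnalyticOnNhd ℂ (fun A : ι → S → 𝔸 => V₃L T U η A A') Set.univ := fun A₀ _ => by
  simp only [V₃L_apply_fun]
  exact AnalyticAt.pi fun μ => AnalyticAt.pi fun x => analyticOnNhd_V₃val T U η A' μ x A₀ trivial

/-- … jointly in `(A, A′)`: `(A, A′) ↦ V₃(A)A′` is entire on `(field space)²`. [folklore] [cite: Balaban1985BackgroundPropagators, p.407 after (3.83)] -/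
theorem analyticOnNhd_V₃L_apply_joint (η : ℝ) :
    AnalyticOnNhd ℂ (fun p : (ι → S → 𝔸) × (ι → S → 𝔸) => V₃L T U η p.1 p.2) Set.univ := fun p₀ _ => by
  simp only [V₃L_apply_fun]
  exact AnalyticAt.pi fun μ => AnalyticAt.pi fun x => analyticOnNhd_V₃val_joint T U η μ x p₀ trivial

/-- COROLLARY: `A ↦ V₃(A)A′` is complex-differentiable everywhere. [folklore] -/
theorem differentiable_V₃L_apply (η : ℝ) (A' : ι → S → 𝔸) : Differentiable ℂ fun A : ι → S → 𝔸 => V₃L T U η A A' :=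
  fun A => (analyticOnNhd_V₃L_apply T U η A' A trivial).differentiableAt

/-- COROLLARY: the operator family `A ↦ V₃(A)` is strongly continuous. [folklore] -/
theorem continuous_V₃L_apply (η : ℝ) (A' : ι → S → 𝔸) : Continuous fun A : ι → S → 𝔸 => V₃L T U η A A' :=
  (differentiable_V₃L_apply T U η A').continuous

end Ops


/-! ## §6 Sanity checks -/

section Examples

variable {𝔸 : Type*} [NormedRing 𝔸] [NormedAlgebra ℂ 𝔸] [CompleteSpace 𝔸] {S : Type*} {ι : Type*}
variable [Fintype ι] [Fintype S] [LinearOrder ι]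
variable (T : ι → Equiv.Perm S) (U : ι → S → 𝔸ˣ)

/-- At `A = 0` the regrouping (3.82) is trivial: both sides are `(Δ + η⁻²DD*)(U)`. -/
example (η : ℝ) : dSumL T (prodCfg U η (0 : ι → S → 𝔸)) η = dSumL T U η := by
  rw [eq382_V₃, V₃L_zero, sub_zero]

/-- `Δ′(U′U) = Δ′(U)` at `A = 0`, as operators. -/
example (η : ℝ) : deltaPrimeL T (prodCfg U η (0 : ι → S → 𝔸)) η = deltaPrimeL T U η := by
  rw [prodCfg_zero]

/-- The operator `V₃(A)` applied to a test field is the lineage's scalar `V₃val`, bond by bond. -/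
example (η : ℝ) (A A' : ι → S → 𝔸) (μ : ι) (x : S) : (V₃L T U η A) A' μ x = V₃val T U η A A' μ x :=
  V₃L_apply T U η A A' μ x

/-- The constant `CV₃` vanishes with `α₁` (no fluctuation allowed ⟹ `V₃ = 0` in operator norm). -/
example (d : ℕ) (η L C₀ : ℝ) (j : ℕ) : CV₃ d η L j 0 C₀ = 0 := by
  unfold CV₃; ring

/-- Strong analyticity at the origin of the field space. -/
example (η : ℝ) (A' : ι → S → 𝔸) : AnalyticAt ℂ (fun A : ι → S → 𝔸 => V₃L T U η A A') 0 :=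
  analyticOnNhd_V₃L_apply T U η A' 0 trivial

end Examples

end Literature.MathematicalPhysics.QuantumFieldTheory.Balaban1983to89.B9Eq382V3Operator

end
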